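import Literature.NumberTheory.Transcendental.HolonomyBoundMeromorphic
import Literature.NumberTheory.Transcendental.HolonomyBoundNevanlinna
import Mathlib.Tactic
import HarnessLib

/-!
# The basic arithmetic holonomy bound with the Nevanlinna characteristic (CDT App. §17, eq. (17.1))

Calegari–Dimitrov–Tang, arXiv:2408.15403, Appendix §17 "A dynamic box principle" (pp. 129–130)
proves the **basic holonomy bound**
`m ≤ 2 T(φ) / (log|φ'(0)| − b₁ − ⋯ − b_r)`  (eq. (17.1) = (basic basic)),
`T(φ) = ∫_𝕋 log⁺|φ| dμ + Σ_{poles ρ ∈ 𝔻} log(1/|ρ|)` the Nevanlinna characteristic (eq. (17.2)),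
for `ℚ(x)`-linearly independent `f₁,…,f_m ∈ ℚ⟦x⟧` of denominator type `(b₁,…,b_r)` with
`φ, φ^*f₁, …, φ^*f_m` simultaneously meromorphic on a neighbourhood of the closed unit disc,
by combining eq. (PZ final) (`HolonomyBoundMeromorphic.holonomyBound_meromorphic`) with
Nevanlinna's lemma (`HolonomyBoundNevanlinna`) and "dilating the radius a little bit".

* `HolonomyBound.holonomyBound_nevanlinna` — holomorphic `φ` (`T(φ) = ⨍_𝕋 log⁺|φ|`; the case
  of all applications in CDT, where `φ ∈ 𝒪(𝔻̄)` and only the pullbacks are meromorphic):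
  `m · (log|φ'(0)| − Σ bⱼ) ≤ 2 ⨍_𝕋 log⁺|φ|`.
* `HolonomyBound.holonomyBound_nevanlinna_meromorphic` — meromorphic `φ = ψ/χ` without poles on
  `𝕋`: `m · (log|φ'(0)| − Σ bⱼ) ≤ 2 (⨍_𝕋 log⁺|φ| + Σ_x (D x)⁻ log(1/|x|))`, `D` the divisor of
  `φ` on the closed unit disc (so `Σ_x (D x)⁻ log(1/|x|) = Σ_{poles ρ∈𝔻} mult(ρ) log(1/|ρ|)`).

In both, the meromorphy of the pullbacks `φ^*fᵢ ∈ ℳ(𝔻̄)` is phrased as in CDT §17.3: a common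
factor `h` with `h(0) = 1` such that each `h · φ^*fᵢ` extends to a function `Gᵢ` holomorphic on
`|z| < R₀` (`R₀ > 1`), bounded on `𝕋`. The limit `R ↓ 1` uses the continuity of
`R ↦ ⨍_{|z|=R} log⁺|φ|` (no poles on `𝕋`) and of the counting term. No named facts.

## References

* [CalegariDimitrovTang2024] arXiv:2408.15403, Appendix §17, eqs. (17.1)/(basic basic), (17.2),
  (PZ final) (pp. 129–130).
-/

noncomputable section

open Filter MeromorphicAt MeasureTheory MeromorphicOn Metric Real Set Topology InnerProductSpace
  Complex
open scoped ComplexConjugate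

namespace Literature.NumberTheory.Transcendental

namespace HolonomyBound

variable {m r : ℕ}

/-! ### The basic holonomy bound with the Nevanlinna characteristic (holomorphic `φ`) -/

/-- **The basic arithmetic holonomy bound, eq. (basic basic), for holomorphic `φ`**
(Calegari–Dimitrov–Tang 2024, Appendix §17, eq. (17.1) = (basic basic) with `T(φ) = ⨍_𝕋 log⁺|φ|`
since `φ` has no poles): for `ℚ(x)`-linearly independent `f₁,…,f_m ∈ ℚ⟦x⟧` of denominator
type `b`, `φ` holomorphic on a neighbourhood `|z| < R₀` (`R₀ > 1`) of the closed unit disc with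
`φ(0) = 0`, germs `gᵢ = φ^*fᵢ` and `h` continuous at `0` with `h(0) = 1` such that each `h · gᵢ`
agrees near `0` with a function `Gᵢ` holomorphic on `|z| < R₀` and bounded on the unit circle
(i.e. `φ^*fᵢ` meromorphic on `𝔻̄`, simultaneously regularised by `h`):
`m · (log|φ'(0)| − Σ_j b_j) ≤ 2 · ⨍_𝕋 log⁺|φ| = 2 T(φ)`.
Proof: Nevanlinna's lemma on `|z| ≤ R` (`1 < R < R₀`) feeds `holonomyBound_meromorphic` with
`M = exp(⨍_{|z|=R} log⁺|φ|)`, then `R → 1⁺`.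
[cite: CalegariDimitrovTang2024, Appendix §17 eqs. (17.1) = (basic basic), (PZ final) and the
concluding paragraph "A well-known lemma of Nevanlinna …" (pp. 129–130)] -/
theorem holonomyBound_nevanlinna (b : Fin r → ℕ) (a : Fin m → ℕ → ℤ)
    (hindep : ∀ D : ℕ, LinearIndependent ℚ (genFamily b a D))
    {φ h : ℂ → ℂ} {G g : Fin m → ℂ → ℂ} {R₀ G' : ℝ} (hR₀ : 1 < R₀)
    (hφ : DifferentiableOn ℂ φ (ball (0 : ℂ) R₀)) (hφ0 : φ 0 = 0)
    (hh : ContinuousAt h 0) (hh0 : h 0 = 1)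
    (hG : ∀ i, DifferentiableOn ℂ (G i) (ball (0 : ℂ) R₀))
    (hgerm : ∀ i, ∀ᶠ z in 𝓝 (0 : ℂ), HasSum (fun k => (cfOf b a i k : ℂ) * φ z ^ k) (g i z))
    (hGg : ∀ i, ∀ᶠ z in 𝓝 (0 : ℂ), G i z = h z * g i z)
    (hGz : ∀ i (z : ℂ), ‖z‖ = 1 → ‖G i z‖ ≤ G') :
    (m : ℝ) * (Real.log ‖deriv φ 0‖ - ∑ j, (b j : ℝ)) ≤
      2 * circleAverage (fun z => log⁺ ‖φ z‖) 0 1 := by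
  set k : ℂ → ℝ := fun z => log⁺ ‖φ z‖ with hk
  have hk0 : ∀ R : ℝ, 0 ≤ circleAverage k 0 R := fun R =>
    circleAverage_nonneg_of_nonneg fun z _ => posLog_nonneg
  have hB0 : 0 ≤ ∑ j, (b j : ℝ) := Finset.sum_nonneg fun j _ => Nat.cast_nonneg _
  have hφan : AnalyticOnNhd ℂ φ (ball (0 : ℂ) R₀) := hφ.analyticOnNhd isOpen_ball
  have hball0 : (0 : ℂ) ∈ ball (0 : ℂ) R₀ := mem_ball_self (by linarith)
  -- the degenerate case `φ ≡ 0` near `0`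
  by_cases hzero : φ =ᶠ[𝓝 (0 : ℂ)] 0
  · have hd : deriv φ 0 = 0 := by
      rw [hzero.deriv_eq]; exact deriv_const 0 0
    rw [hd, norm_zero, Real.log_zero, zero_sub]
    have h1 : (m : ℝ) * -∑ j, (b j : ℝ) ≤ 0 := by
      have : (0 : ℝ) ≤ m := Nat.cast_nonneg _
      nlinarith
    linarith [hk0 1]
  -- orders are finite everywhere on the ball
  have hord : ∀ z ∈ ball (0 : ℂ) R₀, meromorphicOrderAt φ z ≠ ⊤ := by
    intro z hz htop
    apply hzero
    have h1 : analyticOrderAt φ z = ⊤ := by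
      have h := (hφan z hz).meromorphicOrderAt_eq
      rw [htop] at h
      cases h' : analyticOrderAt φ z with
      | top => rfl
      | coe n => rw [h'] at h; simp at h
    rw [analyticOrderAt_eq_top] at h1
    have h2 := hφan.eqOn_zero_of_preconnected_of_eventuallyEq_zero
      (convex_ball (0 : ℂ) R₀).isPreconnected hz h1
    filter_upwards [isOpen_ball.mem_nhds hball0] with x hx using h2 hx
  -- the bound at every radius `R ∈ (1, R₀)`
  have hR : ∀ R : ℝ, 1 < R → R < R₀ →
      (m : ℝ) * (Real.log ‖deriv φ 0‖ - ∑ j, (b j : ℝ)) ≤ 2 * circleAverage k 0 R := by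
    intro R h1R hRR₀
    have hRpos : 0 < R := by linarith
    have hsub : closedBall (0 : ℂ) R ⊆ ball (0 : ℂ) R₀ := closedBall_subset_ball hRR₀
    have hφR : AnalyticOnNhd ℂ φ (closedBall (0 : ℂ) R) := hφan.mono hsub
    obtain ⟨u, v, hu, hv, hu0, hune, hvφ, hbd⟩ :=
      exists_quotient_rep_of_analyticOnNhd hRpos hφR fun z hz => hord z (hsub hz)
    set M : ℝ := Real.exp (circleAverage k 0 R) with hM
    have hM1 : 1 ≤ M := Real.one_le_exp (hk0 R)
    have hballR : ball (0 : ℂ) R ∈ 𝓝 (0 : ℂ) := ball_mem_nhds 0 hRpos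
    -- `v/u = φ` on `|z| < R`
    have hquot : ∀ z ∈ ball (0 : ℂ) R, v z / u z = φ z := by
      intro z hz
      rw [hvφ z hz, mul_div_assoc, div_self (hune z hz), mul_one]
    have hquot_ev : (fun z => v z / u z) =ᶠ[𝓝 (0 : ℂ)] φ := by
      filter_upwards [hballR] with z hz using hquot z hz
    have hderiv : deriv (fun z => v z / u z) 0 = deriv φ 0 := hquot_ev.deriv_eq
    have hv0 : v 0 = 0 := by rw [hvφ 0 (mem_ball_self hRpos), hφ0, zero_mul]
    have hgerm' : ∀ i, ∀ᶠ z in 𝓝 (0 : ℂ),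
        HasSum (fun k => (cfOf b a i k : ℂ) * (v z / u z) ^ k) (g i z) := by
      intro i
      filter_upwards [hgerm i, hballR] with z hz hzR
      rwa [hquot z hzR]
    have hmain := holonomyBound_meromorphic b a hindep h1R hu hv hu0 hv0 hh hh0
      (fun i => (hG i).mono (ball_subset_ball hRR₀.le)) hgerm' hGg hM1
      (fun z hz => (hbd z (by simp only [mem_ball, dist_zero_right, hz]; exact h1R)).1)
      (fun z hz => (hbd z (by simp only [mem_ball, dist_zero_right, hz]; exact h1R)).2) hGz
    rw [hderiv, hM, Real.log_exp] at hmain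
    exact hmain
  -- continuity of `R ↦ ⨍ log⁺|φ|` on `[1, R₁]` and the limit `R → 1⁺`
  set R₁ : ℝ := (1 + R₀) / 2 with hR₁
  have h1R₁ : 1 < R₁ := by rw [hR₁]; linarith
  have hR₁R₀ : R₁ < R₀ := by rw [hR₁]; linarith
  have hcont : ContinuousOn (circleAverage k 0) (Icc 1 R₁) := by
    apply ContinuousOn.circleAverage
    · have hkc : ContinuousOn k (ball (0 : ℂ) R₀) :=
        continuous_posLog.comp_continuousOn hφ.continuousOn.norm
      refine hkc.mono fun z hz => ?_
      simp only [sub_zero, mem_setOf_eq, Set.mem_Icc] at hz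
      simp only [mem_ball, dist_zero_right]
      linarith [hz.2]
    · intro r hr; exact zero_le_one.trans hr.1
  have htend : Tendsto (circleAverage k 0) (𝓝[Ioo 1 R₁] 1) (𝓝 (circleAverage k 0 1)) :=
    ((hcont 1 ⟨le_rfl, h1R₁.le⟩).mono Ioo_subset_Icc_self).tendsto
  haveI : (𝓝[Ioo 1 R₁] 1).NeBot := left_nhdsWithin_Ioo_neBot h1R₁
  have hev : ∀ᶠ R in 𝓝[Ioo 1 R₁] 1,
      (m : ℝ) * (Real.log ‖deriv φ 0‖ - ∑ j, (b j : ℝ)) ≤ 2 * circleAverage k 0 R := by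
    filter_upwards [self_mem_nhdsWithin] with R hR' using hR R hR'.1 (hR'.2.trans hR₁R₀)
  exact ge_of_tendsto (htend.const_mul 2) hev

/-- The counting term `Σ_x (D x)⁻ · log(R/|x|)` of a divisor on the closed disc `|x| ≤ R` is
nonnegative. [folklore] -/
theorem finsum_negPart_mul_log_nonneg {φ : ℂ → ℂ} {R : ℝ} :
    0 ≤ ∑ᶠ x, ((MeromorphicOn.divisor φ (closedBall (0 : ℂ) R) x)⁻ : ℤ) * Real.log (R / ‖x‖) := by
  refine finsum_nonneg fun x => ?_
  by_cases hx : x ∈ closedBall (0 : ℂ) R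
  · refine mul_nonneg (by exact_mod_cast negPart_nonneg _) ?_
    have hx' : ‖x‖ ≤ R := by simpa using hx
    rcases eq_or_ne x 0 with rfl | hx0
    · simp
    · exact Real.log_nonneg ((one_le_div (norm_pos_iff.mpr hx0)).mpr hx')
  · rw [Function.locallyFinsuppWithin.apply_eq_zero_of_notMem _ hx]
    simp

/-- **The basic arithmetic holonomy bound, eq. (basic basic), meromorphic `φ`**
(Calegari–Dimitrov–Tang 2024, Appendix §17, eq. (17.1)): let `f₁,…,f_m ∈ ℚ⟦x⟧` be
`ℚ(x)`-linearly independent of denominator type `b`; let `φ = ψ/χ` with `ψ, χ` holomorphic on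
`|z| < R₀` (`R₀ > 1`), `ψ(0) = 0 ≠ χ(0)` and `χ ≠ 0` on the unit circle (no poles of `φ` on
`𝕋`); let the germs `gᵢ = φ^*fᵢ` be simultaneously regularised by `h` (`h(0) = 1`, `h gᵢ = Gᵢ`
near `0`, `Gᵢ` holomorphic on `|z| < R₀` and bounded by `G` on `𝕋`). Then, with the Nevanlinna
characteristic `T(φ) = ⨍_𝕋 log⁺|φ| + Σ_{poles ρ ∈ 𝔻} mult(ρ) log(1/|ρ|)` (poles counted by the
negative part of the divisor of `φ` on the closed unit disc):
`m · (log|φ'(0)| − Σ_j b_j) ≤ 2 T(φ)`.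
[cite: CalegariDimitrovTang2024, Appendix §17 eqs. (17.1)/(basic basic), (17.2) (p. 129) and the
concluding paragraph of §17.3 (p. 130)] -/
theorem holonomyBound_nevanlinna_meromorphic (b : Fin r → ℕ) (a : Fin m → ℕ → ℤ)
    (hindep : ∀ D : ℕ, LinearIndependent ℚ (genFamily b a D))
    {ψ χ h : ℂ → ℂ} {G g : Fin m → ℂ → ℂ} {R₀ G' : ℝ} (hR₀ : 1 < R₀)
    (hψ : DifferentiableOn ℂ ψ (ball (0 : ℂ) R₀)) (hχ : DifferentiableOn ℂ χ (ball (0 : ℂ) R₀))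
    (hψ0 : ψ 0 = 0) (hχ0 : χ 0 ≠ 0) (hχT : ∀ z : ℂ, ‖z‖ = 1 → χ z ≠ 0)
    (hh : ContinuousAt h 0) (hh0 : h 0 = 1)
    (hG : ∀ i, DifferentiableOn ℂ (G i) (ball (0 : ℂ) R₀))
    (hgerm : ∀ i, ∀ᶠ z in 𝓝 (0 : ℂ),
      HasSum (fun k => (cfOf b a i k : ℂ) * (ψ z / χ z) ^ k) (g i z))
    (hGg : ∀ i, ∀ᶠ z in 𝓝 (0 : ℂ), G i z = h z * g i z)
    (hGz : ∀ i (z : ℂ), ‖z‖ = 1 → ‖G i z‖ ≤ G') :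
    (m : ℝ) * (Real.log ‖deriv (fun z => ψ z / χ z) 0‖ - ∑ j, (b j : ℝ)) ≤
      2 * (circleAverage (fun z => log⁺ ‖ψ z / χ z‖) 0 1 +
        ∑ᶠ x, ((MeromorphicOn.divisor (ψ / χ) (closedBall (0 : ℂ) 1) x)⁻ : ℤ) *
          Real.log (‖x‖⁻¹)) := by
  classical
  set φ : ℂ → ℂ := ψ / χ with hφdef
  have hφap : ∀ z, φ z = ψ z / χ z := fun z => rfl
  have hφfun : (fun z => ψ z / χ z) = φ := rfl
  rw [hφfun]
  set k : ℂ → ℝ := fun z => log⁺ ‖φ z‖ with hk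
  have hkfun : (fun z => log⁺ ‖ψ z / χ z‖) = k := rfl
  rw [hkfun]
  have hk0 : ∀ R : ℝ, 0 ≤ circleAverage k 0 R := fun R =>
    circleAverage_nonneg_of_nonneg fun z _ => posLog_nonneg
  have hB0 : 0 ≤ ∑ j, (b j : ℝ) := Finset.sum_nonneg fun j _ => Nat.cast_nonneg _
  have hN1 : 0 ≤ ∑ᶠ x, ((MeromorphicOn.divisor φ (closedBall (0 : ℂ) 1) x)⁻ : ℤ) *
      Real.log (‖x‖⁻¹) := by
    have := finsum_negPart_mul_log_nonneg (φ := φ) (R := 1)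
    simpa only [one_div] using this
  have hψan : AnalyticOnNhd ℂ ψ (ball (0 : ℂ) R₀) := hψ.analyticOnNhd isOpen_ball
  have hχan : AnalyticOnNhd ℂ χ (ball (0 : ℂ) R₀) := hχ.analyticOnNhd isOpen_ball
  have hball0 : (0 : ℂ) ∈ ball (0 : ℂ) R₀ := mem_ball_self (by linarith)
  have hφa0 : AnalyticAt ℂ φ 0 := (hψan 0 hball0).div (hχan 0 hball0) hχ0
  -- the degenerate case `ψ ≡ 0` near `0`
  by_cases hzero : ψ =ᶠ[𝓝 (0 : ℂ)] 0
  · have hφ0 : φ =ᶠ[𝓝 (0 : ℂ)] 0 := by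
      filter_upwards [hzero] with z hz
      simp [hφap, hz]
    have hd : deriv φ 0 = 0 := by rw [hφ0.deriv_eq]; exact deriv_const 0 0
    rw [hd, norm_zero, Real.log_zero, zero_sub]
    have h1 : (m : ℝ) * -∑ j, (b j : ℝ) ≤ 0 := by
      have : (0 : ℝ) ≤ m := Nat.cast_nonneg _
      nlinarith
    linarith [hk0 1]
  -- finite orders of `ψ` and `χ` on the ball (identity principle)
  have hordψ : ∀ z ∈ ball (0 : ℂ) R₀, meromorphicOrderAt ψ z ≠ ⊤ := by
    intro z hz htop
    apply hzero
    have h1 : analyticOrderAt ψ z = ⊤ := by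
      have h := (hψan z hz).meromorphicOrderAt_eq
      rw [htop] at h
      cases h' : analyticOrderAt ψ z with
      | top => rfl
      | coe n => rw [h'] at h; simp at h
    rw [analyticOrderAt_eq_top] at h1
    have h2 := hψan.eqOn_zero_of_preconnected_of_eventuallyEq_zero
      (convex_ball (0 : ℂ) R₀).isPreconnected hz h1
    filter_upwards [isOpen_ball.mem_nhds hball0] with x hx using h2 hx
  have hordχ : ∀ z ∈ ball (0 : ℂ) R₀, meromorphicOrderAt χ z ≠ ⊤ := by
    intro z hz htop
    have h1 : analyticOrderAt χ z = ⊤ := by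
      have h := (hχan z hz).meromorphicOrderAt_eq
      rw [htop] at h
      cases h' : analyticOrderAt χ z with
      | top => rfl
      | coe n => rw [h'] at h; simp at h
    rw [analyticOrderAt_eq_top] at h1
    have h2 := hχan.eqOn_zero_of_preconnected_of_eventuallyEq_zero
      (convex_ball (0 : ℂ) R₀).isPreconnected hz h1
    exact hχ0 (h2 hball0)
  -- the zeros of `χ` in `|z| ≤ R₁` are finitely many, none on the unit circle: a margin `δ`
  set R₁ : ℝ := (1 + R₀) / 2 with hR₁
  have h1R₁ : 1 < R₁ := by rw [hR₁]; linarith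
  have hR₁R₀ : R₁ < R₀ := by rw [hR₁]; linarith
  have hsub₁ : closedBall (0 : ℂ) R₁ ⊆ ball (0 : ℂ) R₀ := closedBall_subset_ball hR₁R₀
  have hχ₁ : AnalyticOnNhd ℂ χ (closedBall (0 : ℂ) R₁) := hχan.mono hsub₁
  set Dχ := MeromorphicOn.divisor χ (closedBall (0 : ℂ) R₁) with hDχ
  have hDχfin : Dχ.support.Finite := Dχ.finiteSupport (isCompact_closedBall 0 R₁)
  have hzeros : ∀ z ∈ closedBall (0 : ℂ) R₁, χ z = 0 → z ∈ hDχfin.toFinset := by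
    intro z hz hχz
    rw [Set.Finite.mem_toFinset, Function.mem_support, hDχ,
      MeromorphicOn.divisor_apply hχ₁.meromorphicOn hz]
    intro h0
    rw [WithTop.untop₀_eq_zero] at h0
    rcases h0 with h0 | h0
    · exact ((hχ₁ z hz).meromorphicNFAt.meromorphicOrderAt_eq_zero_iff.mp h0) hχz
    · exact hordχ z (hsub₁ hz) h0
  obtain ⟨δ, hδ0, hδ1, hδ⟩ : ∃ δ : ℝ, 0 < δ ∧ 1 + δ < R₁ ∧
      ∀ z ∈ closedBall (0 : ℂ) R₁, χ z = 0 → δ ≤ |‖z‖ - 1| := by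
    set radii : Finset ℝ := (hDχfin.toFinset.filter fun z => χ z = 0).image fun z => |‖z‖ - 1|
      with hradii
    have hpos : ∀ t ∈ radii, 0 < t := by
      intro t ht
      rw [hradii, Finset.mem_image] at ht
      obtain ⟨z, hz, rfl⟩ := ht
      have hχz : χ z = 0 := (Finset.mem_filter.mp hz).2
      have hne : ‖z‖ ≠ 1 := fun h1 => hχT z h1 hχz
      exact abs_pos.mpr (sub_ne_zero.mpr hne)
    by_cases hne : radii.Nonempty
    · set δ₀ := radii.min' hne with hδ₀
      have hδ₀pos : 0 < δ₀ := hpos _ (Finset.min'_mem _ _)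
      refine ⟨min δ₀ ((R₁ - 1) / 2), lt_min hδ₀pos (by linarith), ?_, ?_⟩
      · have := min_le_right δ₀ ((R₁ - 1) / 2); linarith
      · intro z hz hχz
        refine le_trans (min_le_left _ _) (Finset.min'_le _ _ ?_)
        rw [hradii, Finset.mem_image]
        exact ⟨z, Finset.mem_filter.mpr ⟨hzeros z hz hχz, hχz⟩, rfl⟩
    · refine ⟨(R₁ - 1) / 2, by linarith, by linarith, ?_⟩
      intro z hz hχz
      exfalso
      apply hne
      refine ⟨|‖z‖ - 1|, ?_⟩
      rw [hradii, Finset.mem_image]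
      exact ⟨z, Finset.mem_filter.mpr ⟨hzeros z hz hχz, hχz⟩, rfl⟩
  -- for `1 ≤ ‖z‖ < 1 + δ`: `χ z ≠ 0`
  have hχann : ∀ z : ℂ, 1 ≤ ‖z‖ → ‖z‖ < 1 + δ → χ z ≠ 0 := by
    intro z hz1 hz2 hχz
    have hzR₁ : z ∈ closedBall (0 : ℂ) R₁ := by
      simp only [mem_closedBall, dist_zero_right]; linarith
    have := hδ z hzR₁ hχz
    rw [abs_of_nonneg (by linarith)] at this
    linarith
  -- the divisor of `φ` : negative parts at radius `R ∈ (1, 1 + δ)` versus radius `1`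
  have hφmer : ∀ {R : ℝ}, R < R₀ → MeromorphicOn φ (closedBall (0 : ℂ) R) := by
    intro R hR z hz
    have hz' : z ∈ ball (0 : ℂ) R₀ := closedBall_subset_ball hR hz
    exact (hψan z hz').meromorphicAt.div (hχan z hz').meromorphicAt
  have hnegpart : ∀ R : ℝ, 1 < R → R < 1 + δ → ∀ x : ℂ,
      ((MeromorphicOn.divisor φ (closedBall (0 : ℂ) R) x)⁻ : ℤ) =
        (MeromorphicOn.divisor φ (closedBall (0 : ℂ) 1) x)⁻ := by
    intro R h1R hRδ x
    have hRR₀ : R < R₀ := by linarith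
    by_cases hx1 : x ∈ closedBall (0 : ℂ) 1
    · have hxR : x ∈ closedBall (0 : ℂ) R := closedBall_subset_closedBall h1R.le hx1
      rw [MeromorphicOn.divisor_apply (hφmer hRR₀) hxR,
        MeromorphicOn.divisor_apply (hφmer (by linarith)) hx1]
    · rw [Function.locallyFinsuppWithin.apply_eq_zero_of_notMem _ hx1, negPart_zero]
      by_cases hxR : x ∈ closedBall (0 : ℂ) R
      · -- `1 < ‖x‖ ≤ R`: no pole there
        have hx1' : 1 < ‖x‖ := by simpa using hx1
        have hxR' : ‖x‖ ≤ R := by simpa using hxR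
        have hχx : χ x ≠ 0 := hχann x hx1'.le (by linarith)
        have hxb : x ∈ ball (0 : ℂ) R₀ := by
          simp only [mem_ball, dist_zero_right]; linarith
        have han : AnalyticAt ℂ φ x := (hψan x hxb).div (hχan x hxb) hχx
        rw [negPart_eq_zero, MeromorphicOn.divisor_apply (hφmer hRR₀) hxR, WithTop.untop₀_nonneg]
        exact han.meromorphicOrderAt_nonneg
      · rw [Function.locallyFinsuppWithin.apply_eq_zero_of_notMem _ hxR, negPart_zero]
  have hnegpart0 : ((MeromorphicOn.divisor φ (closedBall (0 : ℂ) 1) 0)⁻ : ℤ) = 0 := by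
    rw [negPart_eq_zero, MeromorphicOn.divisor_apply (hφmer (by linarith))
      (mem_closedBall_self zero_le_one), WithTop.untop₀_nonneg]
    exact hφa0.meromorphicOrderAt_nonneg
  set D₁ := MeromorphicOn.divisor φ (closedBall (0 : ℂ) 1) with hD₁
  have hD₁fin : D₁.support.Finite := D₁.finiteSupport (isCompact_closedBall 0 1)
  set s₁ := hD₁fin.toFinset with hs₁
  set C : ℝ := ∑ x ∈ s₁, (((D₁ x)⁻ : ℤ) : ℝ) with hC
  set N₁ : ℝ := ∑ x ∈ s₁, (((D₁ x)⁻ : ℤ) : ℝ) * Real.log (‖x‖⁻¹) with hN₁def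
  have hsupp₁ : ∀ {F : ℂ → ℝ}, (Function.support fun x => (((D₁ x)⁻ : ℤ) : ℝ) * F x) ⊆ s₁ := by
    intro F x hx
    rw [Function.mem_support] at hx
    rw [Finset.mem_coe, hs₁, Set.Finite.mem_toFinset, Function.mem_support]
    intro h0; apply hx; simp [h0]
  have hN₁ : ∑ᶠ x, ((D₁ x)⁻ : ℤ) * Real.log (‖x‖⁻¹) = N₁ := by
    rw [hN₁def]
    exact finsum_eq_sum_of_support_subset _ hsupp₁
  rw [hN₁]
  have hN₁0 : 0 ≤ N₁ := by rw [← hN₁]; exact hN1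
  have hC0 : 0 ≤ C := Finset.sum_nonneg fun x _ => by exact_mod_cast negPart_nonneg _
  have hcount : ∀ R : ℝ, 1 < R → R < 1 + δ →
      ∑ᶠ x, ((MeromorphicOn.divisor φ (closedBall (0 : ℂ) R) x)⁻ : ℤ) * Real.log (R / ‖x‖) =
        C * Real.log R + N₁ := by
    intro R h1R hRδ
    have hR : 0 < R := by linarith
    have hterm : ∀ x, (((MeromorphicOn.divisor φ (closedBall (0 : ℂ) R) x)⁻ : ℤ) : ℝ) *
        Real.log (R / ‖x‖) =
          ((D₁ x)⁻ : ℤ) * (Real.log R + Real.log (‖x‖⁻¹)) := by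
      intro x
      rw [hnegpart R h1R hRδ x]
      rcases eq_or_ne x 0 with rfl | hx0
      · rw [hnegpart0]; simp
      · rw [Real.log_div hR.ne' (norm_ne_zero_iff.mpr hx0), Real.log_inv, sub_eq_add_neg]
    rw [finsum_congr hterm, finsum_eq_sum_of_support_subset _ hsupp₁, hC, hN₁def,
      Finset.sum_mul, ← Finset.sum_add_distrib]
    refine Finset.sum_congr rfl fun x _ => by ring
  -- the bound at every radius `R ∈ (1, 1 + δ)`
  have hRbound : ∀ R : ℝ, 1 < R → R < 1 + δ →
      (m : ℝ) * (Real.log ‖deriv φ 0‖ - ∑ j, (b j : ℝ)) ≤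
        2 * (circleAverage k 0 R + (C * Real.log R + N₁)) := by
    intro R h1R hRδ
    have hRpos : 0 < R := by linarith
    have hRR₀ : R < R₀ := by linarith
    have hsub : closedBall (0 : ℂ) R ⊆ ball (0 : ℂ) R₀ := closedBall_subset_ball hRR₀
    have hχS : ∀ z ∈ sphere (0 : ℂ) R, χ z ≠ 0 := by
      intro z hz
      have hz' : ‖z‖ = R := by simpa using hz
      exact hχann z (by linarith) (by linarith)
    obtain ⟨u, v, hu, hv, hu0, hquot, hbd⟩ := exists_quotient_rep_of_meromorphic hRpos
      (hψan.mono hsub) (hχan.mono hsub) (fun z hz => hordψ z (hsub hz))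
      (fun z hz => hordχ z (hsub hz)) hχ0 hχS
    rw [hcount R h1R hRδ] at hbd
    set T : ℝ := circleAverage k 0 R + (C * Real.log R + N₁) with hT
    have hT0 : 0 ≤ T := by
      have : 0 ≤ C * Real.log R := mul_nonneg hC0 (Real.log_nonneg h1R.le)
      rw [hT]; linarith [hk0 R]
    set M : ℝ := Real.exp T with hM
    have hM1 : 1 ≤ M := Real.one_le_exp hT0
    -- `φ = v/u` near `0`
    have hquot' : (fun z => v z / u z) =ᶠ[𝓝 (0 : ℂ)] φ := by
      filter_upwards [hquot] with z hz
      rw [hφap]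
      exact hz.symm
    have hderiv : deriv (fun z => v z / u z) 0 = deriv φ 0 := hquot'.deriv_eq
    have hv0 : v 0 = 0 := by
      have h1 : φ 0 = v 0 / u 0 := hquot.self_of_nhds
      rw [hu0, div_one, hφap, hψ0, zero_div] at h1
      exact h1.symm
    have hgerm' : ∀ i, ∀ᶠ z in 𝓝 (0 : ℂ),
        HasSum (fun k => (cfOf b a i k : ℂ) * (v z / u z) ^ k) (g i z) := by
      intro i
      filter_upwards [hgerm i, hquot] with z hz hzq
      rw [hzq] at hz
      exact hz
    have hmain := holonomyBound_meromorphic b a hindep h1R hu hv hu0 hv0 hh hh0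
      (fun i => (hG i).mono (ball_subset_ball hRR₀.le)) hgerm' hGg hM1
      (fun z hz => (hbd z (by simp only [mem_ball, dist_zero_right, hz]; exact h1R)).1)
      (fun z hz => (hbd z (by simp only [mem_ball, dist_zero_right, hz]; exact h1R)).2) hGz
    rw [hderiv, hM, Real.log_exp] at hmain
    exact hmain
  -- continuity in `R` and the limit `R → 1⁺`
  set R₂ : ℝ := 1 + δ / 2 with hR₂
  have h1R₂ : 1 < R₂ := by rw [hR₂]; linarith
  have hR₂δ : R₂ < 1 + δ := by rw [hR₂]; linarith
  have hcontk : ContinuousOn (circleAverage k 0) (Icc 1 R₂) := by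
    apply ContinuousOn.circleAverage
    · have hset : {z : ℂ | ‖z - 0‖ ∈ Icc 1 R₂} ⊆ {z : ℂ | 1 ≤ ‖z‖ ∧ ‖z‖ < 1 + δ} := by
        intro z hz
        simp only [sub_zero, mem_setOf_eq, Set.mem_Icc] at hz
        exact ⟨hz.1, by linarith [hz.2]⟩
      have hφc : ContinuousOn φ {z : ℂ | 1 ≤ ‖z‖ ∧ ‖z‖ < 1 + δ} := by
        have hb : {z : ℂ | 1 ≤ ‖z‖ ∧ ‖z‖ < 1 + δ} ⊆ ball (0 : ℂ) R₀ := by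
          intro z hz
          simp only [mem_setOf_eq] at hz
          simp only [mem_ball, dist_zero_right]
          linarith [hz.2]
        rw [hφdef]
        exact (hψ.continuousOn.mono hb).div (hχ.continuousOn.mono hb)
          fun z hz => hχann z hz.1 hz.2
      exact (continuous_posLog.comp_continuousOn hφc.norm).mono hset
    · intro t ht; exact zero_le_one.trans ht.1
  have hcontT : ContinuousOn (fun R => circleAverage k 0 R + (C * Real.log R + N₁)) (Icc 1 R₂) := by
    refine hcontk.add (ContinuousOn.add (continuousOn_const.mul ?_) continuousOn_const)
    exact Real.continuousOn_log.mono fun t ht => by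
      simp only [mem_compl_iff, mem_singleton_iff]; exact ne_of_gt (lt_of_lt_of_le one_pos ht.1)
  have htend : Tendsto (fun R => circleAverage k 0 R + (C * Real.log R + N₁)) (𝓝[Ioo 1 R₂] 1)
      (𝓝 (circleAverage k 0 1 + (C * Real.log 1 + N₁))) :=
    ((hcontT 1 ⟨le_rfl, h1R₂.le⟩).mono Ioo_subset_Icc_self).tendsto
  rw [Real.log_one, mul_zero, zero_add] at htend
  haveI : (𝓝[Ioo 1 R₂] 1).NeBot := left_nhdsWithin_Ioo_neBot h1R₂
  have hev : ∀ᶠ R in 𝓝[Ioo 1 R₂] 1, (m : ℝ) * (Real.log ‖deriv φ 0‖ - ∑ j, (b j : ℝ)) ≤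
      2 * (circleAverage k 0 R + (C * Real.log R + N₁)) := by
    filter_upwards [self_mem_nhdsWithin] with R hR' using hRbound R hR'.1 (hR'.2.trans hR₂δ)
  exact ge_of_tendsto (htend.const_mul 2) hev

end HolonomyBound

end Literature.NumberTheory.Transcendental
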